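import Summits.AtomisticToContinuum.Crystallization.Theorems.GappedShellCensusCleanLimitsHaveWindowsVerticalPinning4
import Summits.AtomisticToContinuum.Crystallization.Theorems.GappedShellCensusCleanLimitsHaveWindowsVerticalPinning6
import Summits.AtomisticToContinuum.Crystallization.Theorems.GappedShellCensusCleanLimitsHaveWindowsLayerCakeBand

/-!
# `GappedShellCensus.CleanLimitsHaveWindows` (stmt-AtomisticToContinuum-15932), line `Sketch`:
# stub `stub_verticalPinning` (T4b-iv, vertical pinning)

Registered stub T4b-iv of the lead skeleton. After in-plane pinning (`191/200 < a' < 99/100`) an exactly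
layered clean hull element `Z = v + A(S(a', s, z))` with rooted-uniformly recurrent point set yields a layered
hull element with all increments in `[39a''/50, 17a''/20]`, `a'' ∈ [47/50, 1]`. If all increments of `z`
already lie in `[39a'/50, 17a'/20]` this is `bp_easyCase` with `a'' = a'`. Otherwise some increment is LOW
(`< 39a'/50`, then all increments are `≤ 83a'/100`) or HIGH (`> 17a'/20`, then all are `≥ 4a'/5`) by the
interlayer bond band of `hgeo`; the bad increment recurs with bounded gaps (part 1), the per-gap vertical move
(widen a LOW gap, shrink a HIGH gap, by `a'/200`) has the certified window gain of parts 3/4 with the pair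
bookkeeping of part 5 (`vp_pair_low`, `vp_pair_high`, `κ > 0`), and the density closing of part 6 against
(U)/(L) at equal cardinality is absurd. [folklore]
-/

noncomputable section

namespace Summit.AtomisticToContinuum.Crystallization.Theorems.CleanHull

open scoped BigOperators
open Finset Filter Literature.MathematicalPhysics.StatisticalMechanics Literature.Geometry.DiscreteGeometry

/-! ## The registry of adjacent layers -/

/-- The offset registry of adjacent layers of a Hägg word. [folklore] -/
theorem vp_hagg_mod {s : ℤ → ℤ} (hs : IsHaggSeq s) (m : ℤ) : (haggLabel s (m + 1) - haggLabel s m) % 3 ≠ 0 := by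
  rw [haggLabel_succ]
  rcases hs m with h | h <;> simp [h]

/-! ## The pair bounds, HIGH -/

/-- The certified near constants for shrinking a HIGH gap (`k = 1, 2, 3`; zero beyond). [folklore] -/
def vpLamH (b : ℝ) (k : ℕ) : ℝ :=
  (b⁻¹) ^ 6 * (if k = 1 then -(835 / 1000) / 1200 else if k = 2 then 428 / 1000 / 1200
    else if k = 3 then 56 / 1000 / 1200 else 0)

/-- `κ_HIGH > 0`. [folklore] -/
theorem vp_kappa_high (b : ℝ) (hb0 : 0 < b) :
    0 < 2 * (∑ k ∈ Finset.range 6, (k : ℝ) * vpLamH b k) - 2 * (0 * (1 / 4 * (6 / 625 + 1 / 375))) := by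
  have h6 : 0 < (b⁻¹) ^ 6 := by positivity
  have e : 2 * (∑ k ∈ Finset.range 6, (k : ℝ) * vpLamH b k) - 2 * (0 * (1 / 4 * (6 / 625 + 1 / 375))) =
      (b⁻¹) ^ 6 * (2 * (-(835 / 1000) / 1200 + 2 * (428 / 1000 / 1200) + 3 * (56 / 1000 / 1200))) := by
    simp only [Finset.sum_range_succ, Finset.sum_range_zero, vpLamH]
    norm_num
    ring
  rw [e]
  exact mul_pos h6 (by norm_num)

/-- **Pair bounds at a HIGH gap.** For `b ≥ 191/200`, a Hägg word, heights with increments in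
`[4b/5, 13b/15]` and a gap `g` with `Δ_g ≥ 17b/20`: every pair `m ≤ g < m'` gains at least the weight
`vpW (vpLamH b) 0` of its distance when the gap is shrunk by `b/200` (parts 3 and 5). [folklore] -/
theorem vp_pair_high (b : ℝ) (hb : 191 / 200 ≤ b) (s : ℤ → ℤ) (hs : IsHaggSeq s)
    (ζ : ℤ → ℝ) (hζ : ∀ l : ℤ, 4 / 5 * b ≤ ζ (l + 1) - ζ l ∧ ζ (l + 1) - ζ l ≤ 13 / 15 * b)
    (g : ℤ) (hg : 17 / 20 * b ≤ ζ (g + 1) - ζ g) (m m' : ℤ) (hm : m ≤ g) (hm' : g < m') :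
    vpW (vpLamH b) 0 (m' - m).toNat ≤
      layerInteraction lennardJones b (ζ m' - ζ m) (haggLabel s m' - haggLabel s m) 1 -
        layerInteraction lennardJones b (ζ m' - ζ m + -(b / 200)) (haggLabel s m' - haggLabel s m) 1 := by
  have hb0 : 0 < b := by linarith
  obtain ⟨hlo, hhi⟩ := vp_pair_height hζ hg (hζ g).2 hm hm'
  rw [← sub_eq_add_neg]
  set k : ℕ := (m' - m).toNat with hk
  have hk1 : 1 ≤ k := by omega
  have hmono : 2 ≤ k → 0 ≤ layerInteraction lennardJones b (ζ m' - ζ m) (haggLabel s m' - haggLabel s m) 1 -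
      layerInteraction lennardJones b (ζ m' - ζ m - b / 200) (haggLabel s m' - haggLabel s m) 1 := by
    intro h2
    have h2' : (2 : ℝ) ≤ k := by exact_mod_cast h2
    exact vp_shrink_nonneg b (by linarith) _ _ _ (by nlinarith) (by linarith)
  by_cases hfar : 5 < k
  · unfold vpW
    rw [if_neg (by omega)]
    simpa using hmono (by omega)
  · unfold vpW
    rw [if_pos (by omega)]
    unfold vpLamH
    interval_cases k
    · have hm1 : m' = m + 1 := by omega
      norm_num at hlo hhi
      rw [if_pos rfl]
      exact vp_high_one b hb (haggLabel s m' - haggLabel s m) (by rw [hm1]; exact vp_hagg_mod hs m)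
        (ζ m' - ζ m) (by linarith) (by linarith)
    · norm_num at hlo hhi
      rw [if_neg (by norm_num), if_pos rfl]
      exact vp_high_two b hb _ (ζ m' - ζ m) (by linarith) (by linarith)
    · norm_num at hlo hhi
      rw [if_neg (by norm_num), if_neg (by norm_num), if_pos rfl]
      exact vp_high_three b hb _ (ζ m' - ζ m) (by linarith) (by linarith)
    · rw [if_neg (by norm_num), if_neg (by norm_num), if_neg (by norm_num), mul_zero]
      exact hmono (by norm_num)
    · rw [if_neg (by norm_num), if_neg (by norm_num), if_neg (by norm_num), mul_zero]
      exact hmono (by norm_num)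

/-! ## The pair bounds, LOW -/

/-- The certified near constants for widening a LOW gap (`k = 1, …, 5`; zero beyond). [folklore] -/
def vpLamL (b : ℝ) (k : ℕ) : ℝ :=
  (b⁻¹) ^ 6 * (if k = 1 then (2723 / 1000 - 83 / 10000) / 1200
    else if k = 2 then (-(868 / 1000) - 108 / 10000) / 1200
    else if k = 3 then (-(119 / 1000) - 87 / 10000) / 1200
    else if k = 4 then (-(28 / 1000) - 57 / 10000) / 1200
    else if k = 5 then (-(9 / 1000) - 35 / 10000) / 1200 else 0)

/-- The far constant for widening a LOW gap: `b⁻⁶ · (7/400) · (30/23)⁵`. [folklore] -/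
def vpMuL (b : ℝ) : ℝ := (b⁻¹) ^ 6 * (7 / 400) * (30 / 23) ^ 5

/-- `κ_LOW > 0`. [folklore] -/
theorem vp_kappa_low (b : ℝ) (hb0 : 0 < b) :
    0 < 2 * (∑ k ∈ Finset.range 6, (k : ℝ) * vpLamL b k) - 2 * (vpMuL b * (1 / 4 * (6 / 625 + 1 / 375))) := by
  have h6 : 0 < (b⁻¹) ^ 6 := by positivity
  have e : 2 * (∑ k ∈ Finset.range 6, (k : ℝ) * vpLamL b k) - 2 * (vpMuL b * (1 / 4 * (6 / 625 + 1 / 375))) =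
      (b⁻¹) ^ 6 * (2 * ((2723 / 1000 - 83 / 10000) / 1200 + 2 * ((-(868 / 1000) - 108 / 10000) / 1200) +
        3 * ((-(119 / 1000) - 87 / 10000) / 1200) + 4 * ((-(28 / 1000) - 57 / 10000) / 1200) +
        5 * ((-(9 / 1000) - 35 / 10000) / 1200)) - 2 * ((7 / 400) * (30 / 23) ^ 5 * (1 / 4 * (6 / 625 + 1 / 375)))) := by
    simp only [Finset.sum_range_succ, Finset.sum_range_zero, vpLamL, vpMuL]
    norm_num
    ring
  rw [e]
  exact mul_pos h6 (by norm_num)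

/-- **Pair bounds at a LOW gap.** For `b ∈ [191/200, 99/100]`, a Hägg word, heights with increments in
`[23b/30, 83b/100]` and a gap `g` with `Δ_g ≤ 39b/50`: every pair `m ≤ g < m'` changes by at least the weight
`vpW (vpLamL b) (vpMuL b)` of its distance when the gap is widened by `b/200` (parts 4 and 5). [folklore] -/
theorem vp_pair_low (b : ℝ) (hb : 191 / 200 ≤ b) (hb1 : b ≤ 99 / 100) (s : ℤ → ℤ) (hs : IsHaggSeq s)
    (ζ : ℤ → ℝ) (hζ : ∀ l : ℤ, 23 / 30 * b ≤ ζ (l + 1) - ζ l ∧ ζ (l + 1) - ζ l ≤ 83 / 100 * b)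
    (g : ℤ) (hg : ζ (g + 1) - ζ g ≤ 39 / 50 * b) (m m' : ℤ) (hm : m ≤ g) (hm' : g < m') :
    vpW (vpLamL b) (vpMuL b) (m' - m).toNat ≤
      layerInteraction lennardJones b (ζ m' - ζ m) (haggLabel s m' - haggLabel s m) 1 -
        layerInteraction lennardJones b (ζ m' - ζ m + b / 200) (haggLabel s m' - haggLabel s m) 1 := by
  have hb0 : 0 < b := by linarith
  obtain ⟨hlo, hhi⟩ := vp_pair_height hζ (hζ g).1 hg hm hm'
  set k : ℕ := (m' - m).toNat with hk
  have hk1 : 1 ≤ k := by omega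
  by_cases hfar : 5 < k
  · -- far pairs
    unfold vpW
    rw [if_neg (by omega)]
    have h6 : (6 : ℝ) ≤ k := by exact_mod_cast hfar
    set H := ζ m' - ζ m with hH
    have hHk : 23 / 30 * b * k ≤ H := by nlinarith
    have hH0 : 0 < H := by nlinarith
    have hfarb := vp_low_far b (by linarith) (haggLabel s m' - haggLabel s m) H (by nlinarith)
    refine le_trans ?_ hfarb
    rw [neg_le_neg_iff]
    unfold vpMuL
    have hk0 : (0 : ℝ) < k := by linarith
    have hratio : b / H ≤ 30 / 23 / k := by
      rw [div_le_div_iff₀ hH0 hk0]; nlinarith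
    have h5 : (b / H) ^ 5 ≤ (30 / 23 / k) ^ 5 := pow_le_pow_left₀ (by positivity) hratio 5
    have e : ((30 : ℝ) / 23 / k) ^ 5 = (30 / 23) ^ 5 * ((k : ℝ)⁻¹) ^ 5 := by
      rw [div_eq_mul_inv, mul_pow]
    rw [e] at h5
    have hc : 0 ≤ (b⁻¹) ^ 6 * (7 / 400) := by positivity
    calc (b⁻¹) ^ 6 * (7 / 400) * (b / H) ^ 5 ≤ (b⁻¹) ^ 6 * (7 / 400) * ((30 / 23) ^ 5 * ((k : ℝ)⁻¹) ^ 5) :=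
          mul_le_mul_of_nonneg_left h5 hc
      _ = (b⁻¹) ^ 6 * (7 / 400) * (30 / 23) ^ 5 * ((k : ℝ)⁻¹) ^ 5 := by ring
  · unfold vpW
    rw [if_pos (by omega)]
    unfold vpLamL
    interval_cases k
    · have hm1 : m' = m + 1 := by omega
      norm_num at hlo hhi
      rw [if_pos rfl]
      exact vp_low_one b (by linarith) hb1 (haggLabel s m' - haggLabel s m) (by rw [hm1]; exact vp_hagg_mod hs m)
        (ζ m' - ζ m) (by linarith) (by linarith)
    · norm_num at hlo hhi
      rw [if_neg (by norm_num), if_pos rfl]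
      exact vp_low_two b (by linarith) hb1 _ (ζ m' - ζ m) (by linarith) (by linarith)
    · norm_num at hlo hhi
      rw [if_neg (by norm_num), if_neg (by norm_num), if_pos rfl]
      exact vp_low_three b (by linarith) hb1 _ (ζ m' - ζ m) (by linarith) (by linarith)
    · norm_num at hlo hhi
      rw [if_neg (by norm_num), if_neg (by norm_num), if_neg (by norm_num), if_pos rfl]
      exact vp_low_four b (by linarith) hb1 _ (ζ m' - ζ m) (by linarith) (by linarith)
    · norm_num at hlo hhi
      rw [if_neg (by norm_num), if_neg (by norm_num), if_neg (by norm_num), if_neg (by norm_num), if_pos rfl]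
      exact vp_low_five b (by linarith) hb1 _ (ζ m' - ζ m) (by linarith) (by linarith)

/-! ## The stub -/

/-- **Stub T4b-iv (vertical / menu pinning).** After in-plane pinning (`191/200 < a' < 99/100`, E1), an exactly layered clean hull
element with rooted-uniformly recurrent point set yields a layered hull element with all increments in `[39a''/50, 17a''/20]` and
spacing in `[47/50, 1]`: the data `(s, Δz)` recur with bounded gaps (from `hrec`), an out-of-box increment therefore recurs with
positive density, and the certified sign of the per-gap vertical move (shrink a high gap / widen a low gap by `a'/200`; lead's
menu numerics: gain `≥ 1.2e-3` per column on the pinned window) against (U)/(L) at equal cardinality prices it linearly in the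
volume (`clo_partB` pattern); in the easy case all increments are already in the box (`bp_easyCase`). NEW (zero-stress equation
of state). [folklore] -/
theorem stub_verticalPinning (x : (N : ℕ) → (Fin N → EuclideanSpace ℝ (Fin 3)))
    (hx : ∀ N, IsGroundState lennardJones (x N)) (a a' : ℝ) (ha : 47 / 50 ≤ a) (ha1 : a ≤ 1) (ha' : 0 < a')
    (A : EuclideanSpace ℝ (Fin 3) →ₗᵢ[ℝ] EuclideanSpace ℝ (Fin 3)) (s : ℤ → ℤ) (z : ℤ → ℝ)
    (v : EuclideanSpace ℝ (Fin 3)) (hs : IsHaggSeq s) (hz : ∀ m : ℤ, 0 < z (m + 1) - z m)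
    (Z : Set (EuclideanSpace ℝ (Fin 3)))
    (hZ : Z = (fun p => p + v) '' {p : EuclideanSpace ℝ (Fin 3) | ∃ m i j : ℤ,
        p = A (((i : ℝ) • triangularVec₁ a') + ((j : ℝ) • triangularVec₂ a') +
          ((haggLabel s m : ℝ) • barlowOffset a') + (z m • layerNormal 1))})
    (hclean : ∀ y ∈ Z, ({w ∈ Z | w ≠ y ∧ dist y w ≤ a * (1 + 1 / 50)}.ncard = 12 ∧
        ∀ w ∈ Z, w ≠ y → a * (1 - 1 / 50) ≤ dist y w ∧
          (dist y w ≤ a * (1 + 1 / 50) ∨ a * (63 / 50) ≤ dist y w)) ∧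
      ∃ T : Finset (EuclideanSpace ℝ (Fin 3)), (↑T : Set (EuclideanSpace ℝ (Fin 3))) =
          (fun w => a⁻¹ • (w - y)) '' {w ∈ Z | w ≠ y ∧ dist y w ≤ a * (1 + 1 / 50)} ∧
        (ShellCloseTo (1 / 5) T fccKissingPattern ∨ ShellCloseTo (1 / 5) T hcpKissingPattern))
    (hH : ∀ R ε : ℝ, 0 < ε → ∃ᶠ N in Filter.atTop, ∃ t : EuclideanSpace ℝ (Fin 3),
        (∀ p ∈ Z, ‖p‖ ≤ R → ∃ i : Fin N, dist (x N i + t) p ≤ ε) ∧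
        (∀ i : Fin N, ‖x N i + t‖ ≤ R → ∃ p ∈ Z, dist (x N i + t) p ≤ ε))
    (hrec : ∀ R ε : ℝ, 0 < ε → ∃ G : ℝ, ∀ w ∈ Z, ∃ g ∈ Z, dist g w ≤ G ∧
      BallMatch ε R 0 ((fun p => p - g) '' Z) Z)
    (hgeo : a * (1 - 1 / 50) ≤ a' ∧ a' ≤ a * (1 + 1 / 50) ∧
      ∀ m : ℤ, (a * (1 - 1 / 50)) ^ 2 ≤ a' ^ 2 / 3 + (z (m + 1) - z m) ^ 2 ∧
        a' ^ 2 / 3 + (z (m + 1) - z m) ^ 2 ≤ (a * (1 + 1 / 50)) ^ 2)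
    (hpin : 191 / 200 < a' ∧ a' < 99 / 100) :
    ∃ (a'' : ℝ) (A' : EuclideanSpace ℝ (Fin 3) →ₗᵢ[ℝ] EuclideanSpace ℝ (Fin 3)) (s' : ℤ → ℤ) (z' : ℤ → ℝ),
      47 / 50 ≤ a'' ∧ a'' ≤ 1 ∧ IsHaggSeq s' ∧
      (∀ m : ℤ, 39 / 50 * a'' ≤ z' (m + 1) - z' m ∧ z' (m + 1) - z' m ≤ 17 / 20 * a'') ∧
      ∀ R ε : ℝ, 0 < ε → ∃ᶠ N in Filter.atTop, ∃ t : EuclideanSpace ℝ (Fin 3),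
        (∀ p ∈ {p : EuclideanSpace ℝ (Fin 3) | ∃ m i j : ℤ, p = A' (((i : ℝ) • triangularVec₁ a'') +
            ((j : ℝ) • triangularVec₂ a'') + ((haggLabel s' m : ℝ) • barlowOffset a'') + (z' m • layerNormal 1))},
          ‖p‖ ≤ R → ∃ i : Fin N, dist (x N i + t) p ≤ ε) ∧
        (∀ i : Fin N, ‖x N i + t‖ ≤ R → ∃ p ∈ {p : EuclideanSpace ℝ (Fin 3) | ∃ m i j : ℤ,
            p = A' (((i : ℝ) • triangularVec₁ a'') + ((j : ℝ) • triangularVec₂ a'') +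
              ((haggLabel s' m : ℝ) • barlowOffset a'') + (z' m • layerNormal 1))},
          dist (x N i + t) p ≤ ε) := by
  classical
  have _hclean := hclean
  obtain ⟨hlo, hhi, hband⟩ := hgeo
  obtain ⟨hpin1, hpin2⟩ := hpin
  have ha0 : 0 < a := by linarith
  have hb : 191 / 200 ≤ a' := hpin1.le
  have hb1 : a' ≤ 99 / 100 := hpin2.le
  -- the untranslated set is in the hull
  have hHS : ∀ R ε : ℝ, 0 < ε → ∃ᶠ N in Filter.atTop, ∃ t : EuclideanSpace ℝ (Fin 3),
      (∀ p ∈ {p : EuclideanSpace ℝ (Fin 3) | ∃ m i j : ℤ, p = A (((i : ℝ) • triangularVec₁ a') +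
          ((j : ℝ) • triangularVec₂ a') + ((haggLabel s m : ℝ) • barlowOffset a') + (z m • layerNormal 1))},
        ‖p‖ ≤ R → ∃ i : Fin N, dist (x N i + t) p ≤ ε) ∧
      (∀ i : Fin N, ‖x N i + t‖ ≤ R → ∃ p ∈ {p : EuclideanSpace ℝ (Fin 3) | ∃ m i j : ℤ,
          p = A (((i : ℝ) • triangularVec₁ a') + ((j : ℝ) • triangularVec₂ a') +
            ((haggLabel s m : ℝ) • barlowOffset a') + (z m • layerNormal 1))}, dist (x N i + t) p ≤ ε) := by
    refine LayeredHull.rec_hull_translate x v hH ?_ ?_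
    · intro p hp; rw [hZ]; exact ⟨p, hp, rfl⟩
    · intro q hq; rw [hZ] at hq; obtain ⟨p, hp, rfl⟩ := hq; simpa using hp
  -- global increment bounds `23a'/30 ≤ Δ ≤ 13a'/15`
  have hΔ : ∀ m : ℤ, 23 / 30 * a' ≤ z (m + 1) - z m ∧ z (m + 1) - z m ≤ 13 / 15 * a' := by
    intro m
    obtain ⟨h1, h2⟩ := hband m
    have hzm := hz m
    constructor
    · have hsq : (23 / 30 * a') ^ 2 ≤ (z (m + 1) - z m) ^ 2 := by nlinarith
      exact (pow_le_pow_iff_left₀ (by positivity) hzm.le two_ne_zero).1 hsq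
    · have hsq : (z (m + 1) - z m) ^ 2 ≤ (13 / 15 * a') ^ 2 := by nlinarith
      exact (pow_le_pow_iff_left₀ hzm.le (by positivity) two_ne_zero).1 hsq
  -- the easy case
  by_cases hbox : ∀ m : ℤ, 39 / 50 * a' ≤ z (m + 1) - z m ∧ z (m + 1) - z m ≤ 17 / 20 * a'
  · exact bp_easyCase x a' (by linarith) (by linarith) A s z v hs hbox Z hZ hH
  exfalso
  obtain ⟨m₀, hm₀⟩ := not_forall.1 hbox
  -- recurrence of the increments
  have hrec' := vp_recurrence A a' s z v Z hZ (23 / 30 * a') (13 / 15 * a') (by positivity) (by linarith)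
    hΔ hrec
  rcases not_and_or.1 hm₀ with hlow | hhigh
  · -- a LOW increment: all increments are `≤ 83a'/100`
    have hlow' : z (m₀ + 1) - z m₀ < 39 / 50 * a' := not_le.1 hlow
    have hq : ∀ m : ℤ, z (m + 1) - z m ≤ 83 / 100 * a' := by
      intro m
      have h1 := (hband m₀).1
      have h2 := (hband m).2
      have hzm := hz m
      have hz0 := hz m₀
      have hΔ0 : (z (m₀ + 1) - z m₀) ^ 2 < (39 / 50 * a') ^ 2 := by nlinarith
      have hsq : (z (m + 1) - z m) ^ 2 ≤ (83 / 100 * a') ^ 2 := by nlinarith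
      exact (pow_le_pow_iff_left₀ hzm.le (by positivity) two_ne_zero).1 hsq
    have hz' : ∀ l : ℤ, 23 / 30 * a' ≤ z (l + 1) - z l ∧ z (l + 1) - z l ≤ 83 / 100 * a' :=
      fun l => ⟨(hΔ l).1, hq l⟩
    -- the bad increment recurs
    have hevent : ∃ G : ℕ, ∀ m : ℤ, ∃ g : ℤ, 0 ≤ g ∧ g ≤ G ∧ z (m + g + 1) - z (m + g) ≤ 39 / 50 * a' := by
      obtain ⟨G, hG⟩ := hrec' (39 / 50 * a' - (z (m₀ + 1) - z m₀)) (by linarith) m₀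
      refine ⟨G, fun m => ?_⟩
      obtain ⟨g, hg0, hgG, hd⟩ := hG m
      exact ⟨g, hg0, hgG, by linarith [(abs_le.1 hd).2]⟩
    refine vp_closing x hx a' (by linarith) (by linarith) A s z (23 / 30) (83 / 100) (by norm_num) hz' hHS
      (a' / 200) (fun Δ => Δ ≤ 39 / 50 * a') (vpLamL a') (vpMuL a') (by unfold vpMuL; positivity)
      (vp_kappa_low a' ha') ?_ ?_ hevent stub_layerCakeBand
    · intro Δ hΔ1 _ hB
      exact ⟨by linarith, by linarith⟩
    · intro ζ hζ g hB m m' hm hm'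
      exact vp_pair_low a' hb hb1 s hs ζ hζ g hB m m' hm hm'
  · -- a HIGH increment: all increments are `≥ 4a'/5`
    have hhigh' : 17 / 20 * a' < z (m₀ + 1) - z m₀ := not_le.1 fun h => hhigh h
    have hp : ∀ m : ℤ, 4 / 5 * a' ≤ z (m + 1) - z m := by
      intro m
      have h1 := (hband m₀).2
      have h2 := (hband m).1
      have hzm := hz m
      have hΔ0 : (17 / 20 * a') ^ 2 < (z (m₀ + 1) - z m₀) ^ 2 := by nlinarith
      have hsq : (4 / 5 * a') ^ 2 ≤ (z (m + 1) - z m) ^ 2 := by nlinarith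
      exact (pow_le_pow_iff_left₀ (by positivity) hzm.le two_ne_zero).1 hsq
    have hz' : ∀ l : ℤ, 4 / 5 * a' ≤ z (l + 1) - z l ∧ z (l + 1) - z l ≤ 13 / 15 * a' :=
      fun l => ⟨hp l, (hΔ l).2⟩
    have hevent : ∃ G : ℕ, ∀ m : ℤ, ∃ g : ℤ, 0 ≤ g ∧ g ≤ G ∧ 17 / 20 * a' ≤ z (m + g + 1) - z (m + g) := by
      obtain ⟨G, hG⟩ := hrec' ((z (m₀ + 1) - z m₀) - 17 / 20 * a') (by linarith) m₀
      refine ⟨G, fun m => ?_⟩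
      obtain ⟨g, hg0, hgG, hd⟩ := hG m
      exact ⟨g, hg0, hgG, by linarith [(abs_le.1 hd).1]⟩
    refine vp_closing x hx a' (by linarith) (by linarith) A s z (4 / 5) (13 / 15) (by norm_num) hz' hHS
      (-(a' / 200)) (fun Δ => 17 / 20 * a' ≤ Δ) (vpLamH a') 0 le_rfl
      (vp_kappa_high a' ha') ?_ ?_ hevent stub_layerCakeBand
    · intro Δ _ hΔ2 hB
      exact ⟨by linarith, by linarith⟩
    · intro ζ hζ g hB m m' hm hm'
      exact vp_pair_high a' hb s hs ζ hζ g hB m m' hm hm'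

end Summit.AtomisticToContinuum.Crystallization.Theorems.CleanHull

end
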